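import Summits.QuantumFields.BalabanUV.T4Continuum.Support.SubstrateGaugeSize

/-!
# SUBSTRATE — ATTAINMENT OF THE GAUGE SIZE: the least common regularity factor of `SubstrateGaugeSize` is WITNESSED whenever any local
# gauge representation with finite bounds exists (`[ProperSpace 𝔸]`, `η, s ≥ 0`) — the honesty lemma «`GaugedAt` ≡ a gauge exists» behind the
# witnessed `Gauged` field of `SubstrateVarProblemOfRecord.recordVP` (typer GO l.~15385, NEXT p2 gen 6 item 1 (2))

Cell `pub-balaban`, SUBSTRATE cell, seat `b2b-balaban-substrate-p2` (gen 2).  Summits-side under the LEAN PLACEMENT RULE.  HONEST FRAMING: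
rung (B)+1 of the FINITE-VOLUME T⁴ programme — NOT infinite volume, NOT a mass gap, NOT Clay; spine PROVED 0∕9; NE3 ∕ NE7 NOT proved; B11
Theorem 1 asserted NOWHERE.  Pure topology∕bookkeeping (Tychonoff + a minimum on a compact set); averaging-agnostic; no estimate.
HONEST DEPENDENCY (cell line, verbatim): continuum YM on T⁴ ⇐ BetaPertH ∧ nine spine estimates (0/9 proved); BetaPertH ⇐ (D1) ∧ (D4) ∧
CAP+tail; G-an2-4 gates asym, D1 and NE2/3/4.

WHAT.
* §5 trimming a witness to the REFERENCED sites (`Refd z R` = the ball and its forward neighbours): `trimB`, `IsGaugeRep.trim`, `RegWithin.trim`,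
  and the GLOBAL bound `norm_trimB_le : ‖trimB … x κ‖ ≤ η·s·t + η²·s²·t`.
* §6 the parameter space `Param d 𝔸 = (Site → 𝔸) × (Site → 𝔸) × (Site → Fin d → 𝔸) × ℝ` (gauge values, their inverses, potential, factor) with the
  PRODUCT topology; the admissible set `admSet V z R η s C₀ T₀` (norm-bounded mutually inverse values, globally bounded potential, factor in
  `[0, T₀]`, the representation identity on the ball, the three bound clauses) is CLOSED (`isClosed_regWithin`, `isClosed_admSet`: evaluations,
  `NormedSpace.exp_continuous`, products) and lies in a product of closed balls × `[0, T₀]`, compact for proper `𝔸` (`isCompact_box`,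
  `isCompact_admSet`); feasible witnesses map into it (`mem_admSet_of_witness`) and its points give feasible factors (`mem_feasible_of_mem_admSet`,
  units assembled from `(a, b)`); **`gaugedAt_of_feasible_nonempty`**: the factor attains its minimum on `admSet` (`IsCompact.exists_isMinOn`) and
  that minimum is a least element of `feasible`, hence `GaugedAt`; `gaugedAt_iff_feasible_nonempty`.
For `𝔸 = Matrix n n ℂ` (the rows' instance, `L²`-operator norm) `ProperSpace` holds by finite dimension.
-/

noncomputable section

open scoped BigOperators

namespace Summit.QuantumFields.BalabanUV.T4Continuum.SubstrateGaugeSizeAttained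

open Literature.MathematicalPhysics.QuantumFieldTheory.Balaban1983to89
open B7Prop1Explicit B11HolderComplex
open NormedSpace SubstrateGaugeSize

variable {d : ℕ} {𝔸 : Type*} [NormedRing 𝔸] [NormOneClass 𝔸] [NormedAlgebra ℂ 𝔸] [CompleteSpace 𝔸]

/-! ## §5 Trimming a witness to the referenced sites -/

/-- The sites whose potential values are referenced by the clauses on the ball: the ball itself and its forward neighbours
`x + e_ι`, `x` in the ball. [folklore] -/
def Refd (z : Site d) (R : ℕ) (x : Site d) : Prop := l1 (x - z) ≤ R ∨ ∃ ι : Fin d, l1 (x - e ι - z) ≤ R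

/-- Membership in the referenced sites is decidable (finitely many coordinate inequalities). [folklore] -/
instance Refd.decidable (z : Site d) (R : ℕ) : DecidablePred (Refd z R) := fun x =>
  inferInstanceAs (Decidable (l1 (x - z) ≤ R ∨ ∃ ι : Fin d, l1 (x - e ι - z) ≤ R))

/-- The trimmed potential: `B` on the referenced sites, `0` elsewhere. [folklore] -/
def trimB (z : Site d) (R : ℕ) (B : Site d → Fin d → 𝔸) : Site d → Fin d → 𝔸 :=
  fun x κ => if Refd z R x then B x κ else 0

omit [NormOneClass 𝔸] [NormedAlgebra ℂ 𝔸] [CompleteSpace 𝔸] in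
/-- On the ball the trimmed potential is the potential. [folklore] -/
theorem trimB_of_mem {z : Site d} {R : ℕ} (B : Site d → Fin d → 𝔸) {x : Site d} (hx : l1 (x - z) ≤ R) (κ : Fin d) :
    trimB z R B x κ = B x κ := by
  simp [trimB, Refd, hx]

omit [NormOneClass 𝔸] [NormedAlgebra ℂ 𝔸] [CompleteSpace 𝔸] in
/-- At a forward neighbour of a ball site the trimmed potential is the potential. [folklore] -/
theorem trimB_shift {z : Site d} {R : ℕ} (B : Site d → Fin d → 𝔸) {x : Site d} (hx : l1 (x - z) ≤ R) (ι κ : Fin d) :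
    trimB z R B (x + e ι) κ = B (x + e ι) κ := by
  have h : Refd z R (x + e ι) := Or.inr ⟨ι, by rwa [add_sub_cancel_right]⟩
  simp [trimB, h]

/-- Trimming keeps the representation on the ball. [folklore] -/
theorem isGaugeRep_trim {V : Site d → Fin d → 𝔸ˣ} {z : Site d} {R : ℕ} {u : Site d → 𝔸ˣ} {B : Site d → Fin d → 𝔸}
    (h : IsGaugeRep V z R u B) : IsGaugeRep V z R u (trimB z R B) := by
  refine ⟨h.1, fun x κ hx => ?_⟩
  rw [h.2 x κ hx]
  simp only [gaugeAct, trimB_of_mem B hx]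

omit [NormOneClass 𝔸] [NormedAlgebra ℂ 𝔸] [CompleteSpace 𝔸] in
/-- Trimming keeps the three bound clauses (they only read referenced sites). [folklore] -/
theorem regWithin_trim {z : Site d} {R : ℕ} {η s t : ℝ} {B : Site d → Fin d → 𝔸} (h : RegWithin z R η s B t) :
    RegWithin z R η s (trimB z R B) t := by
  obtain ⟨h₀, h₁, h₂⟩ := h
  refine ⟨fun x κ hx => ?_, fun x κ ι hx => ?_, fun β hβ0 hβ1 => ?_⟩
  · rw [trimB_of_mem B hx]; exact h₀ x κ hx
  · rw [trimB_shift B hx, trimB_of_mem B hx]; exact h₁ x κ ι hx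
  · intro x x' hP
    have hx : l1 (x - z) ≤ R := hP.1.1
    have hx' : l1 (x' - z) ≤ R := hP.1.2
    have := h₂ β hβ0 hβ1 x x' hP
    simp only [trimB_shift B hx, trimB_of_mem B hx, trimB_shift B hx', trimB_of_mem B hx'] at this ⊢
    exact this

omit [NormOneClass 𝔸] [NormedAlgebra ℂ 𝔸] [CompleteSpace 𝔸] in
/-- The trimmed potential of a feasible witness is GLOBALLY bounded by `η·s·t + η²·s²·t`. [folklore] -/
theorem norm_trimB_le {z : Site d} {R : ℕ} {η s t : ℝ} {B : Site d → Fin d → 𝔸} (h : RegWithin z R η s B t) (hη : 0 ≤ η)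
    (hs : 0 ≤ s) (ht : 0 ≤ t) (x : Site d) (κ : Fin d) : ‖trimB z R B x κ‖ ≤ η * (s * t) + η ^ 2 * (s ^ 2 * t) := by
  have hA : 0 ≤ η * (s * t) := by positivity
  have hC : 0 ≤ η ^ 2 * (s ^ 2 * t) := by positivity
  by_cases hR : Refd z R x
  · simp only [trimB, hR, if_true]
    rcases hR with hx | ⟨ι, hy⟩
    · exact (h.1 x κ hx).trans (le_add_of_nonneg_right hC)
    · have hstep := h.2.1 (x - e ι) κ ι hy
      rw [sub_add_cancel] at hstep
      calc ‖B x κ‖ = ‖B (x - e ι) κ + (B x κ - B (x - e ι) κ)‖ := by rw [add_sub_cancel]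
        _ ≤ ‖B (x - e ι) κ‖ + ‖B x κ - B (x - e ι) κ‖ := norm_add_le _ _
        _ ≤ η * (s * t) + η ^ 2 * (s ^ 2 * t) := add_le_add (h.1 _ κ hy) hstep
  · simp only [trimB, hR, if_false, norm_zero]
    positivity

/-! ## §6 The compact parameter set and the attainment of the gauge size -/

section Compact

/-- The parameter space: `(a, b, B, t)` — candidate gauge values, their inverses, a potential, a factor. [folklore] -/
abbrev Param (d : ℕ) (𝔸 : Type*) : Type _ := (Site d → 𝔸) × (Site d → 𝔸) × (Site d → Fin d → 𝔸) × ℝ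

/-- The ADMISSIBLE parameters: norm-bounded mutually inverse gauge values, a globally bounded potential, a factor in `[0, T₀]`, the
representation of `V` on the ball, and the three bound clauses. [folklore] -/
def admSet (V : Site d → Fin d → 𝔸ˣ) (z : Site d) (R : ℕ) (η s C₀ T₀ : ℝ) : Set (Param d 𝔸) :=
  {p | (∀ x, ‖p.1 x‖ ≤ 1 ∧ ‖p.2.1 x‖ ≤ 1 ∧ p.1 x * p.2.1 x = 1 ∧ p.2.1 x * p.1 x = 1) ∧
       (∀ x κ, ‖p.2.2.1 x κ‖ ≤ C₀) ∧ (0 ≤ p.2.2.2 ∧ p.2.2.2 ≤ T₀) ∧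
       (∀ x κ, l1 (x - z) ≤ R → ((V x κ : 𝔸ˣ) : 𝔸) = p.1 x * exp (p.2.2.1 x κ) * p.2.1 (x + e κ)) ∧
       RegWithin z R η s p.2.2.1 p.2.2.2}

/-- The compact box containing the admissible parameters. [folklore] -/
def box (d : ℕ) (𝔸 : Type*) [NormedRing 𝔸] (C₀ T₀ : ℝ) : Set (Param d 𝔸) :=
  (Set.univ.pi fun _ => Metric.closedBall 0 1) ×ˢ ((Set.univ.pi fun _ => Metric.closedBall 0 1) ×ˢ
    ((Set.univ.pi fun _ => Set.univ.pi fun _ => Metric.closedBall 0 C₀) ×ˢ Set.Icc 0 T₀))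

omit [NormOneClass 𝔸] [NormedAlgebra ℂ 𝔸] [CompleteSpace 𝔸] in
/-- The admissible parameters lie in the box. [folklore] -/
theorem admSet_subset_box (V : Site d → Fin d → 𝔸ˣ) (z : Site d) (R : ℕ) (η s C₀ T₀ : ℝ) :
    admSet V z R η s C₀ T₀ ⊆ box d 𝔸 C₀ T₀ := by
  rintro ⟨a, b, B, t⟩ ⟨hu, hB, ht, -, -⟩
  refine Set.mk_mem_prod (fun x _ => ?_) (Set.mk_mem_prod (fun x _ => ?_) (Set.mk_mem_prod (fun x _ => fun κ _ => ?_) ht))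
  · exact mem_closedBall_zero_iff.mpr (hu x).1
  · exact mem_closedBall_zero_iff.mpr (hu x).2.1
  · exact mem_closedBall_zero_iff.mpr (hB x κ)

omit [NormOneClass 𝔸] [NormedAlgebra ℂ 𝔸] [CompleteSpace 𝔸] in
/-- The box is compact when closed balls of `𝔸` are (Tychonoff). [folklore] -/
theorem isCompact_box [ProperSpace 𝔸] (C₀ T₀ : ℝ) : IsCompact (box d 𝔸 C₀ T₀) :=
  (isCompact_univ_pi fun _ => isCompact_closedBall (0 : 𝔸) 1).prod
    ((isCompact_univ_pi fun _ => isCompact_closedBall (0 : 𝔸) 1).prod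
      ((isCompact_univ_pi fun _ => isCompact_univ_pi fun _ => isCompact_closedBall (0 : 𝔸) C₀).prod isCompact_Icc))

omit [NormOneClass 𝔸] [NormedAlgebra ℂ 𝔸] [CompleteSpace 𝔸] in
/-- The set of `(B, t)` satisfying the three bound clauses is closed. [folklore] -/
theorem isClosed_regWithin (z : Site d) (R : ℕ) (η s : ℝ) :
    IsClosed {q : (Site d → Fin d → 𝔸) × ℝ | RegWithin z R η s q.1 q.2} := by
  have hev : ∀ (x : Site d) (κ : Fin d), Continuous fun q : (Site d → Fin d → 𝔸) × ℝ => q.1 x κ := fun x κ =>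
    (continuous_apply κ).comp ((continuous_apply x).comp continuous_fst)
  have hl1 : Continuous fun q : (Site d → Fin d → 𝔸) × ℝ => η * (s * q.2) := by fun_prop
  have hl2 : Continuous fun q : (Site d → Fin d → 𝔸) × ℝ => η ^ 2 * (s ^ 2 * q.2) := by fun_prop
  have h1 : IsClosed {q : (Site d → Fin d → 𝔸) × ℝ | ∀ x κ, l1 (x - z) ≤ R → ‖q.1 x κ‖ ≤ η * (s * q.2)} := by
    simp only [Set.setOf_forall]
    exact isClosed_iInter fun x => isClosed_iInter fun κ => isClosed_iInter fun _ => isClosed_le (hev x κ).norm hl1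
  have h2 : IsClosed {q : (Site d → Fin d → 𝔸) × ℝ |
      ∀ x κ ι, l1 (x - z) ≤ R → ‖q.1 (x + e ι) κ - q.1 x κ‖ ≤ η ^ 2 * (s ^ 2 * q.2)} := by
    simp only [Set.setOf_forall]
    exact isClosed_iInter fun x => isClosed_iInter fun κ => isClosed_iInter fun ι => isClosed_iInter fun _ =>
      isClosed_le ((hev (x + e ι) κ).sub (hev x κ)).norm hl2
  have h3 : IsClosed {q : (Site d → Fin d → 𝔸) × ℝ | ∀ β : ℝ, 0 ≤ β → β ≤ 1 →
      HolderOn (fun x x' => η * (l1 (x' - x) : ℝ)) β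
        (fun x x' => (l1 (x - z) ≤ R ∧ l1 (x' - z) ≤ R) ∧ η * (l1 (x' - x) : ℝ) ≤ 1)
        (fun x (p : Fin d × Fin d) => q.1 (x + e p.1) p.2 - q.1 x p.2) (η ^ 2 * (s ^ (2 + β) * q.2))} := by
    have hF : ∀ x : Site d, Continuous fun q : (Site d → Fin d → 𝔸) × ℝ =>
        (fun p : Fin d × Fin d => q.1 (x + e p.1) p.2 - q.1 x p.2) := fun x =>
      continuous_pi fun p => (hev (x + e p.1) p.2).sub (hev x p.2)
    have hl3 : ∀ (β : ℝ) (x x' : Site d), Continuous fun q : (Site d → Fin d → 𝔸) × ℝ =>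
        η ^ 2 * (s ^ (2 + β) * q.2) * (η * (l1 (x' - x) : ℝ)) ^ β := fun β x x' => by fun_prop
    simp only [HolderOn, Set.setOf_forall]
    exact isClosed_iInter fun β => isClosed_iInter fun _ => isClosed_iInter fun _ =>
      isClosed_iInter fun x => isClosed_iInter fun x' => isClosed_iInter fun _ =>
        isClosed_le ((hF x').sub (hF x)).norm (hl3 β x x')
  have : {q : (Site d → Fin d → 𝔸) × ℝ | RegWithin z R η s q.1 q.2} = _ ∩ (_ ∩ _) :=
    Set.ext fun q => show RegWithin z R η s q.1 q.2 ↔ q ∈ {q : (Site d → Fin d → 𝔸) × ℝ | _} ∩ ({q | _} ∩ {q | _}) from Iff.rfl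
  rw [this]
  exact h1.inter (h2.inter h3)

omit [NormOneClass 𝔸] in
/-- The admissible parameter set is closed. [folklore] -/
theorem isClosed_admSet (V : Site d → Fin d → 𝔸ˣ) (z : Site d) (R : ℕ) (η s C₀ T₀ : ℝ) :
    IsClosed (admSet V z R η s C₀ T₀) := by
  letI : NormedAlgebra ℚ 𝔸 := NormedAlgebra.restrictScalars ℚ ℂ 𝔸
  have ha : ∀ x : Site d, Continuous fun p : Param d 𝔸 => p.1 x := fun x => (continuous_apply x).comp continuous_fst
  have hb : ∀ x : Site d, Continuous fun p : Param d 𝔸 => p.2.1 x := fun x =>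
    (continuous_apply x).comp (continuous_fst.comp continuous_snd)
  have hBt : Continuous fun p : Param d 𝔸 => (p.2.2.1, p.2.2.2) := continuous_snd.comp continuous_snd
  have hB : ∀ (x : Site d) (κ : Fin d), Continuous fun p : Param d 𝔸 => p.2.2.1 x κ := fun x κ =>
    (continuous_apply κ).comp ((continuous_apply x).comp (continuous_fst.comp hBt))
  have ht : Continuous fun p : Param d 𝔸 => p.2.2.2 := continuous_snd.comp hBt
  have c1 : IsClosed {p : Param d 𝔸 | ∀ x, ‖p.1 x‖ ≤ 1 ∧ ‖p.2.1 x‖ ≤ 1 ∧ p.1 x * p.2.1 x = 1 ∧ p.2.1 x * p.1 x = 1} := by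
    simp only [Set.setOf_forall]
    refine isClosed_iInter fun x => ?_
    simp only [Set.setOf_and]
    exact (isClosed_le (ha x).norm continuous_const).inter ((isClosed_le (hb x).norm continuous_const).inter
      ((isClosed_eq ((ha x).mul (hb x)) continuous_const).inter (isClosed_eq ((hb x).mul (ha x)) continuous_const)))
  have c2 : IsClosed {p : Param d 𝔸 | ∀ x κ, ‖p.2.2.1 x κ‖ ≤ C₀} := by
    simp only [Set.setOf_forall]
    exact isClosed_iInter fun x => isClosed_iInter fun κ => isClosed_le (hB x κ).norm continuous_const
  have c3 : IsClosed {p : Param d 𝔸 | 0 ≤ p.2.2.2 ∧ p.2.2.2 ≤ T₀} := by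
    simp only [Set.setOf_and]
    exact (isClosed_le continuous_const ht).inter (isClosed_le ht continuous_const)
  have c4 : IsClosed {p : Param d 𝔸 |
      ∀ x κ, l1 (x - z) ≤ R → ((V x κ : 𝔸ˣ) : 𝔸) = p.1 x * exp (p.2.2.1 x κ) * p.2.1 (x + e κ)} := by
    simp only [Set.setOf_forall]
    exact isClosed_iInter fun x => isClosed_iInter fun κ => isClosed_iInter fun _ =>
      isClosed_eq continuous_const (((ha x).mul (exp_continuous.comp (hB x κ))).mul (hb (x + e κ)))
  have c5 : IsClosed {p : Param d 𝔸 | RegWithin z R η s p.2.2.1 p.2.2.2} :=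
    (isClosed_regWithin z R η s).preimage hBt
  have : admSet V z R η s C₀ T₀ = _ ∩ (_ ∩ (_ ∩ (_ ∩ _))) :=
    Set.ext fun p => show p ∈ admSet V z R η s C₀ T₀ ↔
      p ∈ {p : Param d 𝔸 | _} ∩ ({p | _} ∩ ({p | _} ∩ ({p | _} ∩ {p | _}))) from Iff.rfl
  rw [this]
  exact c1.inter (c2.inter (c3.inter (c4.inter c5)))

omit [NormOneClass 𝔸] in
/-- The admissible parameter set is compact (`𝔸` proper: closed in the compact box). [folklore] -/
theorem isCompact_admSet [ProperSpace 𝔸] (V : Site d → Fin d → 𝔸ˣ) (z : Site d) (R : ℕ) (η s C₀ T₀ : ℝ) :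
    IsCompact (admSet V z R η s C₀ T₀) :=
  (isCompact_box C₀ T₀).of_isClosed_subset (isClosed_admSet V z R η s C₀ T₀) (admSet_subset_box V z R η s C₀ T₀)

/-- A feasible factor `t ≤ T₀` with its witness, trimmed, is an admissible parameter (bound `C₀ ≥ η·s·t + η²·s²·t`). [folklore] -/
theorem mem_admSet_of_witness {V : Site d → Fin d → 𝔸ˣ} {z : Site d} {R : ℕ} {η s C₀ T₀ t : ℝ} {u : Site d → 𝔸ˣ}
    {B : Site d → Fin d → 𝔸} (hη : 0 ≤ η) (hs : 0 ≤ s) (ht0 : 0 ≤ t) (htT : t ≤ T₀)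
    (hC : η * (s * t) + η ^ 2 * (s ^ 2 * t) ≤ C₀) (hrep : IsGaugeRep V z R u B) (hreg : RegWithin z R η s B t) :
    ((fun x => ((u x : 𝔸ˣ) : 𝔸)), (fun x => (((u x)⁻¹ : 𝔸ˣ) : 𝔸)), trimB z R B, t) ∈ admSet V z R η s C₀ T₀ := by
  refine ⟨fun x => ⟨(mem_U1.mp (hrep.1 x)).1, (mem_U1.mp (hrep.1 x)).2, by simp, by simp⟩,
    fun x κ => (norm_trimB_le hreg hη hs ht0 x κ).trans hC, ⟨ht0, htT⟩, fun x κ hx => ?_, regWithin_trim hreg⟩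
  dsimp only
  have h := congrArg (fun w : 𝔸ˣ => (w : 𝔸)) (hrep.2 x κ hx)
  simp only [gaugeAct, Units.val_mul] at h
  rw [trimB_of_mem B hx, h]
  rfl

/-- An admissible parameter gives a feasible factor (assemble the units from `(a, b)`). [folklore] -/
theorem mem_feasible_of_mem_admSet {V : Site d → Fin d → 𝔸ˣ} {z : Site d} {R : ℕ} {η s C₀ T₀ : ℝ} {p : Param d 𝔸}
    (hp : p ∈ admSet V z R η s C₀ T₀) : p.2.2.2 ∈ feasible V z R η s := by
  obtain ⟨hu, -, ht, hrep, hreg⟩ := hp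
  let u : Site d → 𝔸ˣ := fun x => ⟨p.1 x, p.2.1 x, (hu x).2.2.1, (hu x).2.2.2⟩
  refine ⟨ht.1, u, p.2.2.1, ⟨fun x => mem_U1.mpr ⟨(hu x).1, (hu x).2.1⟩, fun x κ hx => Units.ext ?_⟩, hreg⟩
  simp only [gaugeAct, Units.val_mul]
  rw [hrep x κ hx]
  rfl

/-- **ATTAINMENT: THE LEAST COMMON FACTOR IS WITNESSED.**  On a proper `𝔸` (every matrix algebra), for `η, s ≥ 0`, as soon as SOME local gauge
representation with finite bounds exists (`feasible` nonempty) there is one achieving the infimum `gaugeSize`: `GaugedAt V z R η s`.  Proof: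
trim witnesses to the referenced sites (globally bounded potentials), minimise the factor over the compact set of admissible parameters
(norm-bounded mutually inverse gauge values × bounded potentials × `[0, T₀]`, closed under the representation identity and the three bound
clauses; Tychonoff + `IsCompact.exists_isMinOn`), and observe that the minimum is a least element of `feasible`.  This is the honesty lemma of
the common-factor device: the witnessed `Gauged` of `SubstrateVarProblemOfRecord.recordVP` IS «there exists a gauge transformation u defined on a
neighborhood of □ …» ([Balaban1985Variational] Thm 1 p. 279, the SHAPE) with the least factor. [folklore] -/
theorem gaugedAt_of_feasible_nonempty [ProperSpace 𝔸] {V : Site d → Fin d → 𝔸ˣ} {z : Site d} {R : ℕ} {η s : ℝ} (hη : 0 ≤ η)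
    (hs : 0 ≤ s) (hne : (feasible V z R η s).Nonempty) : GaugedAt V z R η s := by
  obtain ⟨T₀, hT₀⟩ := hne
  obtain ⟨hT0, u₀, B₀, hrep₀, hreg₀⟩ := hT₀
  set C₀ : ℝ := η * (s * T₀) + η ^ 2 * (s ^ 2 * T₀) with hC₀
  have hK := isCompact_admSet V z R η s C₀ T₀
  have hp₀ : ((fun x => ((u₀ x : 𝔸ˣ) : 𝔸)), (fun x => (((u₀ x)⁻¹ : 𝔸ˣ) : 𝔸)), trimB z R B₀, T₀) ∈ admSet V z R η s C₀ T₀ :=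
    mem_admSet_of_witness hη hs hT0 le_rfl le_rfl hrep₀ hreg₀
  have hcont : Continuous fun p : Param d 𝔸 => p.2.2.2 := continuous_snd.comp (continuous_snd.comp continuous_snd)
  obtain ⟨q, hqK, hmin⟩ := hK.exists_isMinOn ⟨_, hp₀⟩ hcont.continuousOn
  have hqfeas : q.2.2.2 ∈ feasible V z R η s := mem_feasible_of_mem_admSet hqK
  have hqT : q.2.2.2 ≤ T₀ := hqK.2.2.1.2
  have hleast : IsLeast (feasible V z R η s) q.2.2.2 := by
    refine ⟨hqfeas, fun t ht => ?_⟩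
    by_cases htT : t ≤ T₀
    · obtain ⟨ht0, u, B, hrep, hreg⟩ := ht
      have hC : η * (s * t) + η ^ 2 * (s ^ 2 * t) ≤ C₀ := by
        rw [hC₀]; gcongr
      have hp : ((fun x => ((u x : 𝔸ˣ) : 𝔸)), (fun x => (((u x)⁻¹ : 𝔸ˣ) : 𝔸)), trimB z R B, t) ∈ admSet V z R η s C₀ T₀ :=
        mem_admSet_of_witness hη hs ht0 htT hC hrep hreg
      exact hmin hp
    · exact hqT.trans (le_of_lt (not_le.mp htT))
  exact (gaugedAt_of_isLeast hleast).2

/-- **THE WITNESSED AND THE PLAIN FORM OF «GAUGED» AGREE** (proper `𝔸`, `η, s ≥ 0`): `GaugedAt ↔ feasible nonempty`. [folklore] -/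
theorem gaugedAt_iff_feasible_nonempty [ProperSpace 𝔸] {V : Site d → Fin d → 𝔸ˣ} {z : Site d} {R : ℕ} {η s : ℝ} (hη : 0 ≤ η)
    (hs : 0 ≤ s) : GaugedAt V z R η s ↔ (feasible V z R η s).Nonempty :=
  ⟨fun h => ⟨_, h⟩, gaugedAt_of_feasible_nonempty hη hs⟩

end Compact

/-! ## §7 The rows' instance: matrix algebras are proper -/

section Matrices

open scoped Matrix.Norms.L2Operator

variable {n : Type*} [Fintype n] [DecidableEq n] [Nonempty n]

omit [Nonempty n] in
/-- `M_n(ℂ)` with the `L²`-operator norm is a proper space (finite dimension over `ℂ`). [folklore] -/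
theorem properSpace_matrix : ProperSpace (Matrix n n ℂ) := FiniteDimensional.proper ℂ (Matrix n n ℂ)

/-- **ATTAINMENT FOR THE ROWS' CARRIER `𝔸 = M_n(ℂ)`** (the instance of `TermwiseHolder.Realises … (Matrix n n ℂ)` and of
`SubstrateVarProblemOfRecord.realisesRecord`): a representation with finite bounds ⇒ `GaugedAt`. [folklore] -/
theorem gaugedAt_of_feasible_nonempty_matrix {V : Site d → Fin d → (Matrix n n ℂ)ˣ} {z : Site d} {R : ℕ} {η s : ℝ} (hη : 0 ≤ η)
    (hs : 0 ≤ s) (hne : (feasible V z R η s).Nonempty) : GaugedAt V z R η s :=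
  haveI : ProperSpace (Matrix n n ℂ) := properSpace_matrix
  gaugedAt_of_feasible_nonempty hη hs hne

end Matrices

end Summit.QuantumFields.BalabanUV.T4Continuum.SubstrateGaugeSizeAttained


end
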